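import Summits.BirchSwinnertonDyer.BirchSwinnertonDyer.Theorems.KolyvaginRankRigidityAtTwoPhantomCongruenceFiltration
import HarnessLib

/-!
# K1⁺ brick 5 — level `2` and THE COUNT: `|H¹(G, (ℤ/2^m)²)| ≤ 2` at cocycle level for `G ↠ GL₂(ℤ/2^m)` (step (4) + assembly)

Crux U1 `KolyvaginBoundedDefectAtTwo` (stmt-BirchSwinnertonDyer-28083), LINE 17, support statement K1⁺ `PhantomLineAtTwo` (pen bsd-idea-1 g13;
memo HOME `line17/K1_row_memo_g13.md` § v3, step (4) and the conclusion). Width seat `bsd-line-krr2-p2` g17; `--supports … --as helper`.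
PURE ALGEBRA, sequel of `…PhantomMatrixCocycles` (steps (1)(2)) and `…PhantomCongruenceFiltration` (step (3)).

* §7 `mcocycle_eq_of_map_eq` (level-`2` transport), `peel` / `clear_entry` / `vanishes_of_level_one_of_generators` (if the four generators
  `γᵢⱼ`, `ρ γᵢⱼ = 1 + 2Eᵢⱼ`, are killed then all of `Γ(2)` is), `generators_eq_zero` (**step (4)**: by `S`-, `U`-equivariance the four
  values are governed by ONE scalar `u = (ψ γ₁₂)₀ ∈ (ℤ/2^m)[2]` — the line `Hom_{S₃}(𝔤𝔩₂(𝔽₂), 𝔽₂²)`);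
* §8 `two_torsion_dichotomy` (`(ℤ/2^m)[2] = {0, 2^(m−1)}`), `exists_coboundary_of_u_eq_zero`, and the CORE THEOREM
  **`atMostTwo_classes`**: for a group `Γ` with a multiplicative `ρ : Γ → M₂(ℤ/2^m)` (`m ≥ 2`) whose image contains every invertible matrix,
  and two vector cocycles `ψ₁, ψ₂` vanishing on `ker ρ` (inflated classes), one of `ψ₁`, `ψ₂`, `ψ₁ − ψ₂` is a coboundary `g ↦ ρ g w − w`.
  This is the all-level, kernel-checked form of the K1 finite-group row (kit j327681/j327693/j327729: `|H¹(GL₂(ℤ/2^m),(ℤ/2^j)²)| = 2`,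
  `2 ≤ m ≤ 10`); the Galois assembly (`PhantomLineAtTwo` itself) is the next file.
Nothing here proves K1⁺'s Galois form, S2, U1 or BSD. [cite: LawsonWuthrich2016, Thm. 1 and §7.1] [cite: Sah1968, Prop. 2.7 (b)]
-/

set_option autoImplicit false
-- the Theorems namespace of this sub repeats the summit name by design (D-0017 nested layout)
set_option linter.dupNamespace false

namespace Summit.BirchSwinnertonDyer.BirchSwinnertonDyer.Theorems.KolyvaginAtTwo.PhantomMatrix

open Matrix

variable {Γ : Type*} [Group Γ] {m : ℕ}

/-! ### §7 Level `2`: a normalised cocycle on `Γ(2)` is determined by one `2`-torsion scalar (step (4)) -/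

section LevelTwo

variable {ρ : Γ → Matrix (Fin 2) (Fin 2) (ZMod (2 ^ m))} {ψ : Γ → Fin 2 → ZMod (2 ^ m)}
variable (φ : ZMod (2 ^ m) →+* ZMod 2)

/-- **Level-`2` transport**: if `Γ(4)` is killed then `ψ` on `Γ(2)` only depends on `ρ γ (mod 4)`'s off-`1` part modulo `2`:
`ρ a = 1 + 2A`, `ρ b = 1 + 2B`, `A ≡ B (mod 2)` ⇒ `ψ b = ψ a`. [folklore] -/
theorem mcocycle_eq_of_map_eq (hρ : ∀ g h, ρ (g * h) = ρ g * ρ h)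
    (hψ : ∀ g h, ψ (g * h) = ψ g + ρ g *ᵥ ψ h) (hφ : ∀ x : ZMod (2 ^ m), φ x = 0 ↔ ∃ c : ZMod (2 ^ m), x = 2 * c)
    (Q2 : ∀ (η : Γ) (X : Matrix (Fin 2) (Fin 2) (ZMod (2 ^ m))), ρ η = 1 + (2 : ZMod (2 ^ m)) ^ 2 • X → ψ η = 0)
    {a b : Γ} {A B : Matrix (Fin 2) (Fin 2) (ZMod (2 ^ m))} (ha : ρ a = 1 + (2 : ZMod (2 ^ m)) • A)
    (hb : ρ b = 1 + (2 : ZMod (2 ^ m)) • B) (hAB : A.map φ = B.map φ) : ψ b = ψ a := by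
  obtain ⟨D, hD⟩ := (map_eq_map_iff φ hφ B A).mp hAB.symm
  have hM := rho_inv_mul_eq hρ ha hb
  set M := ρ (a⁻¹ * b) with hMdef
  set W := B - A * M with hW
  have h1 : A * M = A + (2 : ZMod (2 ^ m)) • (A * W) := by
    rw [hM, mul_add, mul_one, Matrix.mul_smul]
  have hW2 : W = (2 : ZMod (2 ^ m)) • (D - A * W) := by
    have : W = B - A * M := hW
    rw [h1, hD] at this
    calc W = A + (2 : ZMod (2 ^ m)) • D - (A + (2 : ZMod (2 ^ m)) • (A * W)) := this
      _ = (2 : ZMod (2 ^ m)) • (D - A * W) := by rw [smul_sub]; abel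
  have hM4 : M = 1 + (2 : ZMod (2 ^ m)) ^ 2 • (D - A * W) := by
    calc M = 1 + (2 : ZMod (2 ^ m)) • W := hM
      _ = 1 + (2 : ZMod (2 ^ m)) • ((2 : ZMod (2 ^ m)) • (D - A * W)) := by rw [← hW2]
      _ = 1 + (2 : ZMod (2 ^ m)) ^ 2 • (D - A * W) := by rw [smul_smul, pow_two]
  have hQ : ψ (a⁻¹ * b) = 0 := Q2 (a⁻¹ * b) (D - A * W) (by rw [← hMdef]; exact hM4)
  have : b = a * (a⁻¹ * b) := by group
  rw [this, hψ, hQ, mulVec_zero, add_zero]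

end LevelTwo

section LevelOne

variable {ρ : Γ → Matrix (Fin 2) (Fin 2) (ZMod (2 ^ m))} {ψ : Γ → Fin 2 → ZMod (2 ^ m)}
variable (φ : ZMod (2 ^ m) →+* ZMod 2)

/-- **Peeling one generator.** With `ρ γE = 1 + 2E`, `ψ γE = 0` and `ρ γ = 1 + 2X`: the element `γE⁻¹ γ` has `ρ = 1 + 2X'`,
the same `ψ`-value, and `X' ≡ X − E (mod 2)`. [folklore] -/
theorem peel (hρ : ∀ g h, ρ (g * h) = ρ g * ρ h) (hψ : ∀ g h, ψ (g * h) = ψ g + ρ g *ᵥ ψ h)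
    (h2 : ∀ g, (2 : ZMod (2 ^ m)) • ψ g = 0) (hφ : ∀ x : ZMod (2 ^ m), φ x = 0 ↔ ∃ c : ZMod (2 ^ m), x = 2 * c)
    {γE : Γ} {E : Matrix (Fin 2) (Fin 2) (ZMod (2 ^ m))} (hγE : ρ γE = 1 + (2 : ZMod (2 ^ m)) • E) (hψE : ψ γE = 0)
    {γ : Γ} {X : Matrix (Fin 2) (Fin 2) (ZMod (2 ^ m))} (hγ : ρ γ = 1 + (2 : ZMod (2 ^ m)) • X) :
    ρ (γE⁻¹ * γ) = 1 + (2 : ZMod (2 ^ m)) • (X - E * ρ (γE⁻¹ * γ)) ∧ ψ (γE⁻¹ * γ) = ψ γ ∧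
      (X - E * ρ (γE⁻¹ * γ)).map φ = X.map φ - E.map φ := by
  have hM := rho_inv_mul_eq hρ hγE hγ
  refine ⟨hM, ?_, ?_⟩
  · have : γ = γE * (γE⁻¹ * γ) := by group
    conv_rhs => rw [this, mcocycle_mul_of_mod_two hψ h2 hγE, hψE, zero_add]
  · have h1 : (ρ (γE⁻¹ * γ)).map φ = 1 :=
      map_eq_one_of_two_mul φ hφ (c := 1) (X := X - E * ρ (γE⁻¹ * γ)) (by rw [mul_one]; exact hM)
    rw [Matrix.map_sub _ (map_sub φ), Matrix.map_mul, h1, mul_one]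

/-- **Clearing one entry.** Given `ρ γ = 1 + 2X` and a generator `γE` (`ρ γE = 1 + 2E`, `E ≡ E_{ij} (mod 2)`, `ψ γE = 0`), there is
`γ'` with `ρ γ' = 1 + 2X'`, `ψ γ' = ψ γ`, `X' i j ≡ 0` and the other entries of `X'` congruent to those of `X`. [folklore] -/
theorem clear_entry (hρ : ∀ g h, ρ (g * h) = ρ g * ρ h) (hψ : ∀ g h, ψ (g * h) = ψ g + ρ g *ᵥ ψ h)
    (h2 : ∀ g, (2 : ZMod (2 ^ m)) • ψ g = 0) (hφ : ∀ x : ZMod (2 ^ m), φ x = 0 ↔ ∃ c : ZMod (2 ^ m), x = 2 * c)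
    (i j : Fin 2) {γE : Γ} {E : Matrix (Fin 2) (Fin 2) (ZMod (2 ^ m))} (hγE : ρ γE = 1 + (2 : ZMod (2 ^ m)) • E)
    (hψE : ψ γE = 0) (hEij : φ (E i j) = 1) (hE : ∀ i' j', (i' ≠ i ∨ j' ≠ j) → φ (E i' j') = 0)
    {γ : Γ} {X : Matrix (Fin 2) (Fin 2) (ZMod (2 ^ m))} (hγ : ρ γ = 1 + (2 : ZMod (2 ^ m)) • X) :
    ∃ (γ' : Γ) (X' : Matrix (Fin 2) (Fin 2) (ZMod (2 ^ m))), ρ γ' = 1 + (2 : ZMod (2 ^ m)) • X' ∧ ψ γ' = ψ γ ∧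
      φ (X' i j) = 0 ∧ ∀ i' j', (i' ≠ i ∨ j' ≠ j) → φ (X' i' j') = φ (X i' j') := by
  by_cases h0 : φ (X i j) = 0
  · exact ⟨γ, X, hγ, rfl, h0, fun _ _ _ ↦ rfl⟩
  obtain ⟨h1, hψ', hmap⟩ := peel φ hρ hψ h2 hφ hγE hψE hγ
  refine ⟨γE⁻¹ * γ, _, h1, hψ', ?_, fun i' j' hij ↦ ?_⟩
  · have e := congrFun (congrFun hmap i) j
    simp only [map_apply, Matrix.sub_apply] at e
    have ee : (X - E * ρ (γE⁻¹ * γ)) i j = X i j - (E * ρ (γE⁻¹ * γ)) i j := rfl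
    rw [ee, e, hEij]
    have key : ∀ x : ZMod 2, x ≠ 0 → x - 1 = 0 := by decide
    exact key _ h0
  · have e := congrFun (congrFun hmap i') j'
    simp only [map_apply, Matrix.sub_apply] at e
    have ee : (X - E * ρ (γE⁻¹ * γ)) i' j' = X i' j' - (E * ρ (γE⁻¹ * γ)) i' j' := rfl
    rw [ee, e, hE i' j' hij, sub_zero]

set_option maxHeartbeats 400000 in
/-- **If the four generators are killed, all of `Γ(2)` is** (given that `Γ(4)` is): clear the four entries one at a time.
[cite: LawsonWuthrich2016, §7.1] -/
theorem vanishes_of_level_one_of_generators (hρ : ∀ g h, ρ (g * h) = ρ g * ρ h)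
    (hψ : ∀ g h, ψ (g * h) = ψ g + ρ g *ᵥ ψ h) (h2 : ∀ g, (2 : ZMod (2 ^ m)) • ψ g = 0)
    (hφ : ∀ x : ZMod (2 ^ m), φ x = 0 ↔ ∃ c : ZMod (2 ^ m), x = 2 * c)
    (Q2 : ∀ (η : Γ) (X : Matrix (Fin 2) (Fin 2) (ZMod (2 ^ m))), ρ η = 1 + (2 : ZMod (2 ^ m)) ^ 2 • X → ψ η = 0)
    {γ₁₁ γ₁₂ γ₂₁ γ₂₂ : Γ} (h11 : ρ γ₁₁ = 1 + (2 : ZMod (2 ^ m)) • !![1, 0; 0, 0])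
    (h12 : ρ γ₁₂ = 1 + (2 : ZMod (2 ^ m)) • !![0, 1; 0, 0]) (h21 : ρ γ₂₁ = 1 + (2 : ZMod (2 ^ m)) • !![0, 0; 1, 0])
    (h22 : ρ γ₂₂ = 1 + (2 : ZMod (2 ^ m)) • !![0, 0; 0, 1])
    (k11 : ψ γ₁₁ = 0) (k12 : ψ γ₁₂ = 0) (k21 : ψ γ₂₁ = 0) (k22 : ψ γ₂₂ = 0)
    {γ : Γ} {X : Matrix (Fin 2) (Fin 2) (ZMod (2 ^ m))} (hγ : ρ γ = 1 + (2 : ZMod (2 ^ m)) • X) : ψ γ = 0 := by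
  have hφ0 : φ 0 = 0 := map_zero φ
  have hφ1 : φ 1 = 1 := map_one φ
  obtain ⟨γa, Xa, ha, hψa, za, ra⟩ := clear_entry φ hρ hψ h2 hφ 0 0 h11 k11 (by simp [hφ1])
    (by intro i' j' h; fin_cases i' <;> fin_cases j' <;> simp_all) hγ
  obtain ⟨γb, Xb, hb, hψb, zb, rb⟩ := clear_entry φ hρ hψ h2 hφ 0 1 h12 k12 (by simp [hφ1])
    (by intro i' j' h; fin_cases i' <;> fin_cases j' <;> simp_all) ha
  obtain ⟨γc, Xc, hc, hψc, zc, rc⟩ := clear_entry φ hρ hψ h2 hφ 1 0 h21 k21 (by simp [hφ1])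
    (by intro i' j' h; fin_cases i' <;> fin_cases j' <;> simp_all) hb
  obtain ⟨γd, Xd, hd, hψd, zd, rd⟩ := clear_entry φ hρ hψ h2 hφ 1 1 h22 k22 (by simp [hφ1])
    (by intro i' j' h; fin_cases i' <;> fin_cases j' <;> simp_all) hc
  -- all four entries of `Xd` are even
  have e00 : φ (Xd 0 0) = 0 := by
    rw [rd 0 0 (Or.inl Fin.zero_ne_one), rc 0 0 (Or.inl Fin.zero_ne_one), rb 0 0 (Or.inr Fin.zero_ne_one), za]
  have e01 : φ (Xd 0 1) = 0 := by
    rw [rd 0 1 (Or.inl Fin.zero_ne_one), rc 0 1 (Or.inl Fin.zero_ne_one), zb]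
  have e10 : φ (Xd 1 0) = 0 := by
    rw [rd 1 0 (Or.inr Fin.zero_ne_one), zc]
  have hXd : Xd.map φ = (0 : Matrix (Fin 2) (Fin 2) (ZMod (2 ^ m))).map φ := by
    ext i j; fin_cases i <;> fin_cases j <;> simp [e00, e01, e10, zd]
  obtain ⟨D, hD⟩ := (map_eq_map_iff φ hφ _ _).mp hXd
  rw [zero_add] at hD
  have hd' : ρ γd = 1 + (2 : ZMod (2 ^ m)) ^ 2 • D := by rw [hd, hD, smul_smul, pow_two]
  rw [← hψa, ← hψb, ← hψc, ← hψd]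
  exact Q2 _ _ hd'

/-- Conjugates and products of the level-`2` generators over `ℤ/2^m` (exact identities). [folklore] -/
theorem level_one_identities :
    (!![1, 1; 0, 1] : Matrix (Fin 2) (Fin 2) (ZMod (2 ^ m))) * (1 + (2 : ZMod (2 ^ m)) • !![0, 1; 0, 0]) * !![1, -1; 0, 1] =
      1 + (2 : ZMod (2 ^ m)) • !![0, 1; 0, 0] ∧
    (!![0, 1; 1, 0] : Matrix (Fin 2) (Fin 2) (ZMod (2 ^ m))) * (1 + (2 : ZMod (2 ^ m)) • !![0, 1; 0, 0]) * !![0, 1; 1, 0] =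
      1 + (2 : ZMod (2 ^ m)) • !![0, 0; 1, 0] ∧
    (!![0, 1; 1, 0] : Matrix (Fin 2) (Fin 2) (ZMod (2 ^ m))) * (1 + (2 : ZMod (2 ^ m)) • !![1, 0; 0, 0]) * !![0, 1; 1, 0] =
      1 + (2 : ZMod (2 ^ m)) • !![0, 0; 0, 1] ∧
    (!![1, 1; 0, 1] : Matrix (Fin 2) (Fin 2) (ZMod (2 ^ m))) * (1 + (2 : ZMod (2 ^ m)) • !![1, 0; 0, 0]) * !![1, -1; 0, 1] =
      1 + (2 : ZMod (2 ^ m)) • !![1, -1; 0, 0] ∧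
    (1 + (2 : ZMod (2 ^ m)) • !![1, 0; 0, 0] : Matrix (Fin 2) (Fin 2) (ZMod (2 ^ m))) * (1 + (2 : ZMod (2 ^ m)) • !![0, 1; 0, 0]) =
      1 + (2 : ZMod (2 ^ m)) • !![1, 3; 0, 0] ∧
    (!![1, 1; 0, 1] : Matrix (Fin 2) (Fin 2) (ZMod (2 ^ m))) * (1 + (2 : ZMod (2 ^ m)) • !![0, 0; 0, 1]) * !![1, -1; 0, 1] =
      1 + (2 : ZMod (2 ^ m)) • !![0, 1; 0, 1] ∧
    (1 + (2 : ZMod (2 ^ m)) • !![0, 1; 0, 0] : Matrix (Fin 2) (Fin 2) (ZMod (2 ^ m))) * (1 + (2 : ZMod (2 ^ m)) • !![0, 0; 0, 1]) =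
      1 + (2 : ZMod (2 ^ m)) • !![0, 3; 0, 1] := by
  rw [one_fin_two]
  refine ⟨?_, ?_, ?_, ?_, ?_, ?_, ?_⟩ <;>
  · ext i j; fin_cases i <;> fin_cases j <;> simp [Matrix.mul_apply, Fin.sum_univ_two] <;> ring

/-- **Step (4): the generator values are governed by ONE scalar.** For a normalised cocycle (2-torsion values, `ker ρ` killed,
`Γ(4)` killed) and generators `γᵢⱼ` with `ρ γᵢⱼ = 1 + 2Eᵢⱼ`: if the first coordinate of `ψ γ₁₂` vanishes then all four `ψ γᵢⱼ`
vanish (`S`-, `U`-equivariance: `Hom_{S₃}(𝔤𝔩₂(𝔽₂), V)` is a line — cf. the pen's `equivariant_maps_gl2_to_V`). [cite: LawsonWuthrich2016, §7.1] -/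
theorem generators_eq_zero (hρ : ∀ g h, ρ (g * h) = ρ g * ρ h) (hρ1 : ρ 1 = 1)
    (hψ : ∀ g h, ψ (g * h) = ψ g + ρ g *ᵥ ψ h) (hN : ∀ n, ρ n = 1 → ψ n = 0) (h2 : ∀ g, (2 : ZMod (2 ^ m)) • ψ g = 0)
    (hφ : ∀ x : ZMod (2 ^ m), φ x = 0 ↔ ∃ c : ZMod (2 ^ m), x = 2 * c)
    (Q2 : ∀ (η : Γ) (X : Matrix (Fin 2) (Fin 2) (ZMod (2 ^ m))), ρ η = 1 + (2 : ZMod (2 ^ m)) ^ 2 • X → ψ η = 0)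
    {s t : Γ} (hs : ρ s = !![0, 1; 1, 0]) (ht : ρ t = !![1, 1; 0, 1])
    {γ₁₁ γ₁₂ γ₂₁ γ₂₂ : Γ} (h11 : ρ γ₁₁ = 1 + (2 : ZMod (2 ^ m)) • !![1, 0; 0, 0])
    (h12 : ρ γ₁₂ = 1 + (2 : ZMod (2 ^ m)) • !![0, 1; 0, 0]) (h21 : ρ γ₂₁ = 1 + (2 : ZMod (2 ^ m)) • !![0, 0; 1, 0])
    (h22 : ρ γ₂₂ = 1 + (2 : ZMod (2 ^ m)) • !![0, 0; 0, 1]) (hu : ψ γ₁₂ 0 = 0) :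
    ψ γ₁₁ = 0 ∧ ψ γ₁₂ = 0 ∧ ψ γ₂₁ = 0 ∧ ψ γ₂₂ = 0 := by
  obtain ⟨hsi, hti⟩ := rho_inv_named hρ hρ1 hs ht
  obtain ⟨c12t, c12s, c11s, c11t, p1112, c22t, p1222⟩ := level_one_identities (m := m)
  have hfix : ∀ {γ' : Γ} {E : Matrix (Fin 2) (Fin 2) (ZMod (2 ^ m))}, ρ γ' = 1 + (2 : ZMod (2 ^ m)) • E →
      ∀ g : Γ, ρ γ' *ᵥ ψ g⁻¹ = ψ g⁻¹ := fun hE g ↦ mulVec_eq_self_of_mod_two hE (h2 _)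
  -- (E1) `U f₁₂ = f₁₂`
  have E1 : !![1, 1; 0, 1] *ᵥ ψ γ₁₂ = ψ γ₁₂ := by
    rw [← ht, ← mcocycle_conj hψ hρ1 hρ t γ₁₂ (hfix h12 t)]
    exact mcocycle_eq_of_rho_eq hρ hρ1 hψ hN (by rw [hρ, hρ, ht, h12, hti, c12t])
  -- (E2) `S f₁₂ = f₂₁`
  have E2 : !![0, 1; 1, 0] *ᵥ ψ γ₁₂ = ψ γ₂₁ := by
    rw [← hs, ← mcocycle_conj hψ hρ1 hρ s γ₁₂ (hfix h12 s)]
    exact mcocycle_eq_of_rho_eq hρ hρ1 hψ hN (by rw [hρ, hρ, hs, h12, hsi, c12s, h21])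
  -- (E3) `S f₁₁ = f₂₂`
  have E3 : !![0, 1; 1, 0] *ᵥ ψ γ₁₁ = ψ γ₂₂ := by
    rw [← hs, ← mcocycle_conj hψ hρ1 hρ s γ₁₁ (hfix h11 s)]
    exact mcocycle_eq_of_rho_eq hρ hρ1 hψ hN (by rw [hρ, hρ, hs, h11, hsi, c11s, h22])
  -- (E4) `U f₁₁ = f₁₁ + f₁₂`
  have E4 : !![1, 1; 0, 1] *ᵥ ψ γ₁₁ = ψ γ₁₁ + ψ γ₁₂ := by
    rw [← ht, ← mcocycle_conj hψ hρ1 hρ t γ₁₁ (hfix h11 t), ← mcocycle_mul_of_mod_two hψ h2 h11 γ₁₂]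
    have ha : ρ (γ₁₁ * γ₁₂) = 1 + (2 : ZMod (2 ^ m)) • !![1, 3; 0, 0] := by rw [hρ, h11, h12, p1112]
    have hb : ρ (t * γ₁₁ * t⁻¹) = 1 + (2 : ZMod (2 ^ m)) • !![1, -1; 0, 0] := by rw [hρ, hρ, ht, h11, hti, c11t]
    refine mcocycle_eq_of_map_eq φ hρ hψ hφ Q2 ha hb ?_
    have h2' : φ 2 = 0 := (hφ 2).mpr ⟨1, by ring⟩
    have h3 : φ 3 = φ (-1) := by
      have : (3 : ZMod (2 ^ m)) = -1 + 2 * 2 := by ring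
      rw [this, map_add, map_mul, h2', mul_zero, add_zero]
    ext i j; fin_cases i <;> fin_cases j <;> simp [h3]
  -- (E5) `U f₂₂ = f₁₂ + f₂₂`
  have E5 : !![1, 1; 0, 1] *ᵥ ψ γ₂₂ = ψ γ₁₂ + ψ γ₂₂ := by
    rw [← ht, ← mcocycle_conj hψ hρ1 hρ t γ₂₂ (hfix h22 t), ← mcocycle_mul_of_mod_two hψ h2 h12 γ₂₂]
    have ha : ρ (γ₁₂ * γ₂₂) = 1 + (2 : ZMod (2 ^ m)) • !![0, 3; 0, 1] := by rw [hρ, h12, h22, p1222]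
    have hb : ρ (t * γ₂₂ * t⁻¹) = 1 + (2 : ZMod (2 ^ m)) • !![0, 1; 0, 1] := by rw [hρ, hρ, ht, h22, hti, c22t]
    refine mcocycle_eq_of_map_eq φ hρ hψ hφ Q2 ha hb ?_
    have h2' : φ 2 = 0 := (hφ 2).mpr ⟨1, by ring⟩
    have h3 : φ 3 = φ 1 := by
      have : (3 : ZMod (2 ^ m)) = 1 + 2 := by ring
      rw [this, map_add, h2', add_zero]
    ext i j; fin_cases i <;> fin_cases j <;> simp [h3]
  -- solve the linear system
  rw [mulVec_fin_two] at E1 E2 E3 E4 E5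
  have E1_0 := congrFun E1 0
  have E2_0 := congrFun E2 0
  have E2_1 := congrFun E2 1
  have E3_0 := congrFun E3 0
  have E3_1 := congrFun E3 1
  have E4_0 := congrFun E4 0
  have E5_0 := congrFun E5 0
  simp only [Pi.add_apply, of_apply, cons_val', cons_val_zero, cons_val_one, cons_val_fin_one, empty_val', zero_mul, one_mul,
    zero_add, add_zero] at E1_0 E2_0 E2_1 E3_0 E3_1 E4_0 E5_0
  -- E1_0 : f12 0 + f12 1 = f12 0 ; E2_0 : f12 1 = f21 0 ; E2_1 : f12 0 = f21 1 ; E3_0 : f11 1 = f22 0 ; E3_1 : f11 0 = f22 1 ;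
  -- E4_0 : f11 0 + f11 1 = f11 0 + f12 0 ; E5_0 : f22 0 + f22 1 = f12 0 + f22 0
  have a12_1 : ψ γ₁₂ 1 = 0 := by linear_combination E1_0
  have a11_1 : ψ γ₁₁ 1 = 0 := by linear_combination E4_0 + hu
  have a22_1 : ψ γ₂₂ 1 = 0 := by linear_combination E5_0 + hu
  have a11_0 : ψ γ₁₁ 0 = 0 := by linear_combination E3_1 + a22_1
  have a22_0 : ψ γ₂₂ 0 = 0 := by linear_combination -E3_0 + a11_1
  have a21_0 : ψ γ₂₁ 0 = 0 := by linear_combination -E2_0 + a12_1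
  have a21_1 : ψ γ₂₁ 1 = 0 := by linear_combination -E2_1 + hu
  refine ⟨?_, ?_, ?_, ?_⟩ <;> ext i <;> fin_cases i <;> simp [hu, a12_1, a11_0, a11_1, a22_0, a22_1, a21_0, a21_1]

end LevelOne

/-! ### §8 The count: at most two classes -/

section Core

variable {ρ : Γ → Matrix (Fin 2) (Fin 2) (ZMod (2 ^ m))}

/-- **`(ℤ/2^m)[2] = {0, 2^(m−1)}`** (`m ≥ 1`). [folklore] -/
theorem two_torsion_dichotomy (hm : 1 ≤ m) {x : ZMod (2 ^ m)} (hx : (2 : ZMod (2 ^ m)) * x = 0) :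
    x = 0 ∨ x = ((2 ^ (m - 1) : ℕ) : ZMod (2 ^ m)) := by
  haveI : NeZero (2 ^ m) := ⟨pow_ne_zero _ two_ne_zero⟩
  have hlt : x.val < 2 ^ m := ZMod.val_lt x
  have hdvd : 2 ^ m ∣ 2 * x.val := by
    rw [← ZMod.natCast_eq_zero_iff]
    push_cast
    rw [ZMod.natCast_zmod_val]; exact hx
  have hm' : 2 ^ m = 2 * 2 ^ (m - 1) := by
    rw [← pow_succ']; congr 1; omega
  have hdvd2 : 2 * 2 ^ (m - 1) ∣ 2 * x.val := by rw [← hm']; exact hdvd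
  have hlt2 : x.val < 2 * 2 ^ (m - 1) := by rw [← hm']; exact hlt
  obtain ⟨q, hq⟩ := Nat.dvd_of_mul_dvd_mul_left two_pos hdvd2
  have hq2 : q < 2 := by
    by_contra hq2
    have : 2 * 2 ^ (m - 1) ≤ x.val := by rw [hq]; nlinarith
    omega
  interval_cases q
  · left
    rw [mul_zero] at hq
    exact (ZMod.val_eq_zero x).mp hq
  · right
    rw [mul_one] at hq
    rw [← hq, ZMod.natCast_zmod_val]

/-- A normalised cocycle whose scalar `u = (ψ γ₁₂)₀` vanishes is a coboundary (steps (2)–(4) combined). [folklore] -/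
theorem exists_coboundary_of_u_eq_zero (hm : 1 ≤ m) (hρ : ∀ g h, ρ (g * h) = ρ g * ρ h) (hρ1 : ρ 1 = 1)
    (hsurj : ∀ M : Matrix (Fin 2) (Fin 2) (ZMod (2 ^ m)), IsUnit M → ∃ γ, ρ γ = M)
    {ψ : Γ → Fin 2 → ZMod (2 ^ m)} (hψ : ∀ g h, ψ (g * h) = ψ g + ρ g *ᵥ ψ h) (hN : ∀ n, ρ n = 1 → ψ n = 0)
    (h2 : ∀ g, (2 : ZMod (2 ^ m)) • ψ g = 0) {s t : Γ} (hs : ρ s = !![0, 1; 1, 0]) (ht : ρ t = !![1, 1; 0, 1])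
    {γ₁₁ γ₁₂ γ₂₁ γ₂₂ : Γ} (h11 : ρ γ₁₁ = 1 + (2 : ZMod (2 ^ m)) • !![1, 0; 0, 0])
    (h12 : ρ γ₁₂ = 1 + (2 : ZMod (2 ^ m)) • !![0, 1; 0, 0]) (h21 : ρ γ₂₁ = 1 + (2 : ZMod (2 ^ m)) • !![0, 0; 1, 0])
    (h22 : ρ γ₂₂ = 1 + (2 : ZMod (2 ^ m)) • !![0, 0; 0, 1]) (hu : ψ γ₁₂ 0 = 0) :
    ∃ w : Fin 2 → ZMod (2 ^ m), ∀ g, ψ g = ρ g *ᵥ w - w := by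
  set φ₂ : ZMod (2 ^ m) →+* ZMod 2 := ZMod.castHom (dvd_pow_self 2 (by omega) : 2 ∣ 2 ^ m) (ZMod 2) with hφ₂
  have hφ : ∀ x : ZMod (2 ^ m), φ₂ x = 0 ↔ ∃ c : ZMod (2 ^ m), x = 2 * c := castHom_two_eq_zero_iff hm
  have Q2 : ∀ (η : Γ) (X : Matrix (Fin 2) (Fin 2) (ZMod (2 ^ m))), ρ η = 1 + (2 : ZMod (2 ^ m)) ^ 2 • X → ψ η = 0 :=
    fun η X hη ↦ vanishes_of_level_two hm hρ hρ1 hsurj hψ hN h2 hs ht hη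
  obtain ⟨k11, k12, k21, k22⟩ := generators_eq_zero φ₂ hρ hρ1 hψ hN h2 hφ Q2 hs ht h11 h12 h21 h22 hu
  have hΓ2 : ∀ γ, (∃ C : Matrix (Fin 2) (Fin 2) (ZMod (2 ^ m)), ρ γ = 1 + (2 : ZMod (2 ^ m)) • C) → ψ γ = 0 :=
    fun γ ⟨C, hC⟩ ↦ vanishes_of_level_one_of_generators φ₂ hρ hψ h2 hφ Q2 h11 h12 h21 h22 k11 k12 k21 k22 hC
  obtain ⟨w, -, hw⟩ := exists_coboundary_of_vanishes_mod_two φ₂ hφ hρ hρ1 hψ h2 hΓ2 hs ht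
  exact ⟨w, hw⟩

/-- **THE CORE THEOREM — `|H¹(G, (ℤ/2^m)²)| ≤ 2` at cocycle level for a group `Γ` mapping ONTO `GL₂(ℤ/2^m)`, `m ≥ 2`.**
For two vector-valued crossed homomorphisms `ψ₁, ψ₂ : Γ → (ℤ/2^m)²` over a multiplicative `ρ : Γ → M₂(ℤ/2^m)` whose image contains
every invertible matrix, both vanishing on `ker ρ` (inflated classes): `ψ₁`, `ψ₂` or `ψ₁ − ψ₂` is a coboundary `g ↦ ρ g w − w`.
Proof = steps (1)–(4) of the pen's memo (`K1_row_memo_g13.md` § v3): normal form against `−1` (brick 3), the scalar `u ∈ (ℤ/2^m)[2] = {0, 2^(m−1)}`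
of step (4), and "`u = 0` ⇒ coboundary" (`exists_coboundary_of_u_eq_zero`). This is the finite-group content of K1⁺ `PhantomLineAtTwo`
(kit rows j327681/j327693/j327729: `= 2` exactly for `2 ≤ m ≤ 10`). [cite: LawsonWuthrich2016, Thm. 1 and §7.1] [cite: Sah1968, Prop. 2.7 (b)] -/
theorem atMostTwo_classes (hm : 2 ≤ m) (hρ : ∀ g h, ρ (g * h) = ρ g * ρ h) (hρ1 : ρ 1 = 1)
    (hsurj : ∀ M : Matrix (Fin 2) (Fin 2) (ZMod (2 ^ m)), IsUnit M → ∃ γ, ρ γ = M)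
    {ψ₁ ψ₂ : Γ → Fin 2 → ZMod (2 ^ m)} (hψ₁ : ∀ g h, ψ₁ (g * h) = ψ₁ g + ρ g *ᵥ ψ₁ h)
    (hψ₂ : ∀ g h, ψ₂ (g * h) = ψ₂ g + ρ g *ᵥ ψ₂ h) (hN₁ : ∀ n, ρ n = 1 → ψ₁ n = 0) (hN₂ : ∀ n, ρ n = 1 → ψ₂ n = 0) :
    (∃ w : Fin 2 → ZMod (2 ^ m), ∀ g, ψ₁ g = ρ g *ᵥ w - w) ∨ (∃ w : Fin 2 → ZMod (2 ^ m), ∀ g, ψ₂ g = ρ g *ᵥ w - w) ∨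
      (∃ w : Fin 2 → ZMod (2 ^ m), ∀ g, ψ₁ g - ψ₂ g = ρ g *ᵥ w - w) := by
  have hm1 : 1 ≤ m := by omega
  -- named elements
  have hSunit : IsUnit (!![0, 1; 1, 0] : Matrix (Fin 2) (Fin 2) (ZMod (2 ^ m))) := by
    rw [Matrix.isUnit_iff_isUnit_det, det_fin_two]; simp
  have hUunit : IsUnit (!![1, 1; 0, 1] : Matrix (Fin 2) (Fin 2) (ZMod (2 ^ m))) := by
    rw [Matrix.isUnit_iff_isUnit_det, det_fin_two]; simp
  obtain ⟨z, hz⟩ := hsurj (-1) isUnit_one.neg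
  obtain ⟨s, hs⟩ := hsurj _ hSunit
  obtain ⟨t, ht⟩ := hsurj _ hUunit
  obtain ⟨γ₁₁, h11⟩ := hsurj _ (isUnit_one_add_two_smul (!![1, 0; 0, 0] : Matrix (Fin 2) (Fin 2) (ZMod (2 ^ m))))
  obtain ⟨γ₁₂, h12⟩ := hsurj _ (isUnit_one_add_two_smul (!![0, 1; 0, 0] : Matrix (Fin 2) (Fin 2) (ZMod (2 ^ m))))
  obtain ⟨γ₂₁, h21⟩ := hsurj _ (isUnit_one_add_two_smul (!![0, 0; 1, 0] : Matrix (Fin 2) (Fin 2) (ZMod (2 ^ m))))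
  obtain ⟨γ₂₂, h22⟩ := hsurj _ (isUnit_one_add_two_smul (!![0, 0; 0, 1] : Matrix (Fin 2) (Fin 2) (ZMod (2 ^ m))))
  -- normal forms `χᵢ = ψᵢ + ∂bᵢ` (2-torsion-valued cocycles vanishing on `ker ρ`)
  obtain ⟨b₁, hb₁, -⟩ := exists_shift_normal_form hρ hρ1 hψ₁ hN₁ hz hs ht
  obtain ⟨b₂, hb₂, -⟩ := exists_shift_normal_form hρ hρ1 hψ₂ hN₂ hz hs ht
  obtain ⟨hc₁, hn₁⟩ := shift_mcocycle hρ hψ₁ hN₁ b₁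
  obtain ⟨hc₂, hn₂⟩ := shift_mcocycle hρ hψ₂ hN₂ b₂
  -- the scalars `u₁, u₂ ∈ R[2] = {0, 2^(m-1)}`
  have hu₁ : (2 : ZMod (2 ^ m)) * (ψ₁ γ₁₂ + (ρ γ₁₂ *ᵥ b₁ - b₁)) 0 = 0 := by
    have := congrFun (hb₁ γ₁₂) 0; simpa using this
  have hu₂ : (2 : ZMod (2 ^ m)) * (ψ₂ γ₁₂ + (ρ γ₁₂ *ᵥ b₂ - b₂)) 0 = 0 := by
    have := congrFun (hb₂ γ₁₂) 0; simpa using this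
  rcases two_torsion_dichotomy hm1 hu₁ with h₁ | h₁
  · -- `ψ₁` is a coboundary
    left
    obtain ⟨w, hw⟩ := exists_coboundary_of_u_eq_zero (ψ := fun g ↦ ψ₁ g + (ρ g *ᵥ b₁ - b₁)) hm1 hρ hρ1 hsurj hc₁ hn₁
      hb₁ hs ht h11 h12 h21 h22 h₁
    refine ⟨w - b₁, fun g ↦ ?_⟩
    have e := hw g
    rw [mulVec_sub]
    linear_combination e
  rcases two_torsion_dichotomy hm1 hu₂ with h₂ | h₂
  · right; left
    obtain ⟨w, hw⟩ := exists_coboundary_of_u_eq_zero (ψ := fun g ↦ ψ₂ g + (ρ g *ᵥ b₂ - b₂)) hm1 hρ hρ1 hsurj hc₂ hn₂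
      hb₂ hs ht h11 h12 h21 h22 h₂
    refine ⟨w - b₂, fun g ↦ ?_⟩
    have e := hw g
    rw [mulVec_sub]
    linear_combination e
  -- both scalars equal `2^(m-1)`: the difference is a coboundary
  right; right
  have hc : ∀ g h, ((ψ₁ (g * h) + (ρ (g * h) *ᵥ b₁ - b₁)) - (ψ₂ (g * h) + (ρ (g * h) *ᵥ b₂ - b₂))) =
      ((ψ₁ g + (ρ g *ᵥ b₁ - b₁)) - (ψ₂ g + (ρ g *ᵥ b₂ - b₂))) +
        ρ g *ᵥ ((ψ₁ h + (ρ h *ᵥ b₁ - b₁)) - (ψ₂ h + (ρ h *ᵥ b₂ - b₂))) :=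
    mcocycle_sub (ψ₁ := fun g ↦ ψ₁ g + (ρ g *ᵥ b₁ - b₁)) (ψ₂ := fun g ↦ ψ₂ g + (ρ g *ᵥ b₂ - b₂)) hc₁ hc₂
  have hn : ∀ n, ρ n = 1 → (ψ₁ n + (ρ n *ᵥ b₁ - b₁)) - (ψ₂ n + (ρ n *ᵥ b₂ - b₂)) = 0 := fun n hn' ↦ by
    rw [hn₁ n hn', hn₂ n hn', sub_self]
  have hb : ∀ g, (2 : ZMod (2 ^ m)) • ((ψ₁ g + (ρ g *ᵥ b₁ - b₁)) - (ψ₂ g + (ρ g *ᵥ b₂ - b₂))) = 0 := fun g ↦ by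
    rw [smul_sub, hb₁ g, hb₂ g, sub_self]
  have hu : ((ψ₁ γ₁₂ + (ρ γ₁₂ *ᵥ b₁ - b₁)) - (ψ₂ γ₁₂ + (ρ γ₁₂ *ᵥ b₂ - b₂))) 0 = 0 := by
    rw [Pi.sub_apply, h₁, h₂, sub_self]
  obtain ⟨w, hw⟩ := exists_coboundary_of_u_eq_zero
    (ψ := fun g ↦ (ψ₁ g + (ρ g *ᵥ b₁ - b₁)) - (ψ₂ g + (ρ g *ᵥ b₂ - b₂))) hm1 hρ hρ1 hsurj hc hn hb hs ht h11 h12 h21 h22 hu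
  refine ⟨w - b₁ + b₂, fun g ↦ ?_⟩
  have e := hw g
  rw [mulVec_add, mulVec_sub]
  linear_combination e

end Core

end Summit.BirchSwinnertonDyer.BirchSwinnertonDyer.Theorems.KolyvaginAtTwo.PhantomMatrix
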